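import Literature.AlgebraicTopology.SingularHomology.MayerVietorisKernelPart
import Literature.Geometry.ComplexAnalytic.PhamBrieskornA3TwoBallDatum
import HarnessLib

/-!
# The ball piece at a d6 point: local facts on the `τ² = −1` part of `H₂` from the Mayer–Vietoris cover `(piece ∖ E) ∪ nbhd(E)`

Family `hodge`, layer `Literature/Geometry/ComplexAnalytic`; theorems only (no definition, no named fact). Written by the prover seat
`hodge-nonav-prover-Ax` (g18) for crux K1Q, stub S5 (`Summits/HodgeConjecture/HodgeConjecture/Theses/Q8SymplecticPowers.lean`). The three local
hypotheses (`hrank₁`, `hloc₁`, `hloc₂`) and the finiteness of `H₂` of the ball pieces in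
`Summit…Q8MonodromyBireflectionLocalConfiguration.monodromyBireflection_of_localConfiguration`, derived from: an open cover `A = U ∪ V` of the piece
with `H₁(U ∩ V; ℚ) = H₂(U ∩ V; ℚ) = 0` (`Literature…MayerVietorisKernelPart`), `τ|² = +1` on `H₂(V; ℚ)` (the neighbourhood of the exceptional
curves), and `U` modelled ON HOMOLOGY on the free quotient `F°∕ι` of the punctured `A₃` Milnor fibre (`PhamBrieskornA3TwoBallDatum.localPiece_of_homologyConj`,
`PhamBrieskornA3QuotientPieceHomology.quotientPiece_package_homology`): `(e ∘ h|U)_* = (h̄ ∘ e)_*` and `(e ∘ τ|U)_* = (τ̄ ∘ e)_*` (first piece),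
resp. `(e ∘ τ³|U)_* = (τ̄ ∘ e)_*` (second piece, the `j`-conjugate: `j⁻¹ τ j = τ⁻¹`).

* `finite_of_mayerVietoris` — `H₂(A; ℚ)` is finite-dimensional when `H₂(U), H₂(V)` are and the overlap is as above.
* **`ballPiece_facts₁`** — `dim ker((τ|A)_*² + 1) = 2` and `(h|A)_* = (τ|A)_*` on it.
* **`ballPiece_facts₂`** — `(h|A)_* (τ|A)_* = 1` on `ker((τ|A)_*² + 1)` (given `τ⁴ = id` on `A`).

## References

* [HatcherAT2002] A. Hatcher, Algebraic Topology, CUP 2002, §2.2 p. 149, §2.1.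
* [Milnor1968] J. Milnor, Singular Points of Complex Hypersurfaces, §9 Thm. 9.1.
-/

noncomputable section

open CategoryTheory Limits Set ContinuousMap
open Literature.AlgebraicTopology.SingularHomology

namespace Literature.Geometry.ComplexAnalytic

namespace PhamBrieskorn

section BallPiece

variable {ζ : ℂ} (hζ : IsPrimitiveRoot ζ 4) {A : Type} [TopologicalSpace A]

attribute [local instance] OrbitSpace.homeoMulAction

/-- `H₂(A; ℚ)` is finite-dimensional for a cover `A = U ∪ V` with `H₂(U ∩ V) = H₁(U ∩ V) = 0` and `H₂(U), H₂(V)` finite-dimensional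
(every class is `i_U* a + i_V* b`). [cite: HatcherAT2002, §2.2 p. 149] -/
theorem finite_of_mayerVietoris {U V : Set A} (hUo : IsOpen U) (hVo : IsOpen V) (hUV : U ∪ V = univ) (n : ℕ)
    (hI₁ : IsZero (singularHomology ℚ ℚ ↥(U ∩ V) (n + 1))) (hI₀ : IsZero (singularHomology ℚ ℚ ↥(U ∩ V) n))
    [Module.Finite ℚ (singularHomology ℚ ℚ U (n + 1))] [Module.Finite ℚ (singularHomology ℚ ℚ V (n + 1))] :
    Module.Finite ℚ (singularHomology ℚ ℚ A (n + 1)) := by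
  have hUV' : interior U ∪ interior V = univ := by rw [hUo.interior_eq, hVo.interior_eq, hUV]
  have htop : (LinearMap.range (singularHomology.map ℚ ℚ (subsetIncl U) (n + 1)).hom ⊔
      LinearMap.range (singularHomology.map ℚ ℚ (subsetIncl V) (n + 1)).hom) = ⊤ := by
    rw [eq_top_iff]
    intro x _
    obtain ⟨a, b, rfl⟩ := exists_eq_add_of_isZero ℚ ℚ U V hUV' n hI₁ hI₀ x
    exact Submodule.add_mem_sup ⟨a, rfl⟩ ⟨b, rfl⟩
  have hfg : (⊤ : Submodule ℚ (singularHomology ℚ ℚ A (n + 1))).FG := by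
    rw [← htop, LinearMap.range_eq_map, LinearMap.range_eq_map]
    exact Submodule.FG.sup (Submodule.FG.map _ Module.Finite.fg_top) (Submodule.FG.map _ Module.Finite.fg_top)
  exact Module.Finite.of_fg_top hfg

/-- **First ball piece.** `A = U ∪ V` open, `H₂(U ∩ V; ℚ) = H₁(U ∩ V; ℚ) = 0`; self-maps `g` (monodromy) and `s` (deck) of `A` with `s`
preserving `U, V`, `g` preserving `U`; `(s|V)_*² = +1` on `H₂(V)`; a homeomorphism `e : U ≃ₜ F°∕ι` with `(e ∘ g|U)_* = (h̄ ∘ e)_*` and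
`(e ∘ s|U)_* = (τ̄ ∘ e)_*` on `H₂`. Then `dim ker(s_*² + 1) = 2` on `H₂(A; ℚ)` and `g_* = s_*` there. [cite: Milnor1968, §9 Thm. 9.1]
[cite: HatcherAT2002, §2.2 p. 149] -/
theorem ballPiece_facts₁ {U V : Set A} (hUo : IsOpen U) (hVo : IsOpen V) (hUV : U ∪ V = univ)
    (hI₁ : IsZero (singularHomology ℚ ℚ ↥(U ∩ V) 2)) (hI₀ : IsZero (singularHomology ℚ ℚ ↥(U ∩ V) 1))
    (s g : C(A, A)) (hsU : MapsTo s U U) (hsV : MapsTo s V V) (hgU : MapsTo g U U)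
    (hsV2 : ∀ v : singularHomology ℚ ℚ V 2, singularHomology.map ℚ ℚ (singularHomology.restrictSelf s hsV) 2
      (singularHomology.map ℚ ℚ (singularHomology.restrictSelf s hsV) 2 v) = v)
    (e : ↥U ≃ₜ OrbitSpace (iotaPunct 4 four_ne_zero (by decide)))
    (heg : singularHomology.map ℚ ℚ ((e : C(↥U, OrbitSpace (iotaPunct 4 four_ne_zero (by decide)))).comp
        (singularHomology.restrictSelf g hgU)) 2 =
      singularHomology.map ℚ ℚ (((OrbitSpace.map (negPairPunct 4 * rotatePunct 4 four_ne_zero ⟨ζ, hζ.pow_eq_one⟩)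
        (commute_modelPunct_iotaPunct 4 four_ne_zero (by decide) ⟨ζ, hζ.pow_eq_one⟩)) :
          C(OrbitSpace (iotaPunct 4 four_ne_zero (by decide)), OrbitSpace (iotaPunct 4 four_ne_zero (by decide)))).comp
        (e : C(↥U, OrbitSpace (iotaPunct 4 four_ne_zero (by decide))))) 2)
    (hes : singularHomology.map ℚ ℚ ((e : C(↥U, OrbitSpace (iotaPunct 4 four_ne_zero (by decide)))).comp
        (singularHomology.restrictSelf s hsU)) 2 =
      singularHomology.map ℚ ℚ (((OrbitSpace.map (rotatePunct 4 four_ne_zero ⟨ζ, hζ.pow_eq_one⟩)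
        (commute_rotatePunct_iotaPunct 4 four_ne_zero (by decide) ⟨ζ, hζ.pow_eq_one⟩)) :
          C(OrbitSpace (iotaPunct 4 four_ne_zero (by decide)), OrbitSpace (iotaPunct 4 four_ne_zero (by decide)))).comp
        (e : C(↥U, OrbitSpace (iotaPunct 4 four_ne_zero (by decide))))) 2) :
    Module.finrank ℚ ↥(Module.End.eigenspace ((singularHomology.map ℚ ℚ s 2).hom ^ 2) (-1 : ℚ)) = 2 ∧
    (∀ x : singularHomology ℚ ℚ A 2, singularHomology.map ℚ ℚ s 2 (singularHomology.map ℚ ℚ s 2 x) = -x →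
      singularHomology.map ℚ ℚ g 2 x = singularHomology.map ℚ ℚ s 2 x) := by
  obtain ⟨hdimQ, hsqQ, hmodQ⟩ := quotientPiece_package_homology hζ
  obtain ⟨hdimU, hsU2, hgU'⟩ := singularHomology.localPiece_of_homologyConj ℚ e (singularHomology.restrictSelf g hgU)
    (singularHomology.restrictSelf s hsU) _ _ 2 heg hes hsqQ hmodQ
  haveI : Module.Finite ℚ (singularHomology ℚ ℚ (OrbitSpace (iotaPunct 4 four_ne_zero (by decide))) 2) :=
    Module.finite_of_finrank_pos (by rw [hdimQ]; exact two_pos)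
  haveI : Module.Finite ℚ (singularHomology ℚ ℚ U 2) := Module.Finite.equiv (singularHomology.mapIso ℚ ℚ e 2).toLinearEquiv.symm
  refine ⟨?_, fun x hx => map_eq_on_kernelPart hUo hVo hUV 1 hI₁ hI₀ s g hsU hsV hgU hsU2 hsV2 hgU' x hx⟩
  rw [finrank_kernelPart_of_mayerVietoris hUo hVo hUV 1 hI₁ hI₀ s hsU hsV hsU2 hsV2, hdimU, hdimQ]

/-- **Second ball piece** (the `j`-conjugate): as `ballPiece_facts₁` but with `s³|U` modelled on `τ̄` and `s⁴ = id` on `A`; then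
`g_* s_* = 1` on `ker(s_*² + 1) ⊆ H₂(A; ℚ)`. [cite: Milnor1968, §9 Thm. 9.1] [cite: HatcherAT2002, §2.2 p. 149] -/
theorem ballPiece_facts₂ {U V : Set A} (hUo : IsOpen U) (hVo : IsOpen V) (hUV : U ∪ V = univ)
    (hI₁ : IsZero (singularHomology ℚ ℚ ↥(U ∩ V) 2)) (hI₀ : IsZero (singularHomology ℚ ℚ ↥(U ∩ V) 1))
    (s g : C(A, A)) (hsU : MapsTo s U U) (hsV : MapsTo s V V) (hgU : MapsTo g U U) (hs4 : ∀ x, s (s (s (s x))) = x)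
    (hsV2 : ∀ v : singularHomology ℚ ℚ V 2, singularHomology.map ℚ ℚ (singularHomology.restrictSelf s hsV) 2
      (singularHomology.map ℚ ℚ (singularHomology.restrictSelf s hsV) 2 v) = v)
    (e : ↥U ≃ₜ OrbitSpace (iotaPunct 4 four_ne_zero (by decide)))
    (heg : singularHomology.map ℚ ℚ ((e : C(↥U, OrbitSpace (iotaPunct 4 four_ne_zero (by decide)))).comp
        (singularHomology.restrictSelf g hgU)) 2 =
      singularHomology.map ℚ ℚ (((OrbitSpace.map (negPairPunct 4 * rotatePunct 4 four_ne_zero ⟨ζ, hζ.pow_eq_one⟩)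
        (commute_modelPunct_iotaPunct 4 four_ne_zero (by decide) ⟨ζ, hζ.pow_eq_one⟩)) :
          C(OrbitSpace (iotaPunct 4 four_ne_zero (by decide)), OrbitSpace (iotaPunct 4 four_ne_zero (by decide)))).comp
        (e : C(↥U, OrbitSpace (iotaPunct 4 four_ne_zero (by decide))))) 2)
    (hes : singularHomology.map ℚ ℚ ((e : C(↥U, OrbitSpace (iotaPunct 4 four_ne_zero (by decide)))).comp
        ((singularHomology.restrictSelf s hsU).comp ((singularHomology.restrictSelf s hsU).comp (singularHomology.restrictSelf s hsU)))) 2 =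
      singularHomology.map ℚ ℚ (((OrbitSpace.map (rotatePunct 4 four_ne_zero ⟨ζ, hζ.pow_eq_one⟩)
        (commute_rotatePunct_iotaPunct 4 four_ne_zero (by decide) ⟨ζ, hζ.pow_eq_one⟩)) :
          C(OrbitSpace (iotaPunct 4 four_ne_zero (by decide)), OrbitSpace (iotaPunct 4 four_ne_zero (by decide)))).comp
        (e : C(↥U, OrbitSpace (iotaPunct 4 four_ne_zero (by decide))))) 2) :
    ∀ x : singularHomology ℚ ℚ A 2, singularHomology.map ℚ ℚ s 2 (singularHomology.map ℚ ℚ s 2 x) = -x →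
      singularHomology.map ℚ ℚ g 2 (singularHomology.map ℚ ℚ s 2 x) = x := by
  obtain ⟨-, hsqQ, hmodQ⟩ := quotientPiece_package_homology hζ
  obtain ⟨-, hs3, hg3⟩ := singularHomology.localPiece_of_homologyConj ℚ e (singularHomology.restrictSelf g hgU)
    ((singularHomology.restrictSelf s hsU).comp ((singularHomology.restrictSelf s hsU).comp (singularHomology.restrictSelf s hsU)))
    _ _ 2 heg hes hsqQ hmodQ
  have hU4 := singularHomology.map_restrictSelf_pow_four ℚ s hsU hs4 2
  -- `(s|U)_*² = −1` from `((s|U)³)_*² = −1` and `(s|U)_*⁴ = 1`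
  have hsU2 : ∀ u : singularHomology ℚ ℚ U 2, singularHomology.map ℚ ℚ (singularHomology.restrictSelf s hsU) 2
      (singularHomology.map ℚ ℚ (singularHomology.restrictSelf s hsU) 2 u) = -u := fun u => by
    have h3 := hs3 (singularHomology.map ℚ ℚ (singularHomology.restrictSelf s hsU) 2
      (singularHomology.map ℚ ℚ (singularHomology.restrictSelf s hsU) 2 u))
    simp only [singularHomology.map_comp, ModuleCat.comp_apply] at h3
    rw [hU4, hU4] at h3
    exact neg_eq_iff_eq_neg.mp h3.symm
  -- `(g|U)_* (s|U)_* = 1` from `(g|U)_* = (s|U)³_*`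
  have hgs : ∀ u : singularHomology ℚ ℚ U 2, singularHomology.map ℚ ℚ (singularHomology.restrictSelf g hgU) 2
      (singularHomology.map ℚ ℚ (singularHomology.restrictSelf s hsU) 2 u) = u := fun u => by
    rw [hg3]
    simp only [singularHomology.map_comp, ModuleCat.comp_apply]
    exact hU4 u
  exact fun x hx => map_map_eq_on_kernelPart hUo hVo hUV 1 hI₁ hI₀ s g hsU hsV hgU hsU2 hsV2 hgs x hx

end BallPiece

end PhamBrieskorn

end Literature.Geometry.ComplexAnalytic

end
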